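import Literature.Probability.Percolation.MacroscopicInterfaceLoop
import Literature.Probability.Percolation.ArmSeparationGlue
import HarnessLib

/-!
# Polychromatic two-arm events are interface crossings of the annulus

Topic: Probability / Percolation. The deterministic lattice input common to the two routes to
the two-arm exponent `1/4` of critical site percolation on `𝕋` recorded in
`ArmExponentsTwoArm.lean` — the scaling limit of S. Smirnov, W. Werner, *Critical exponents for
two-dimensional percolation*, Math. Res. Lett. **8** (2001), §4 (named fact
`SmirnovWerner2001_twoArm_scalingLimit`, (16): via the Camia–Newman loop ensemble
`triLoopCollection` / `exists_isCNLFamily_tendsto` of `CLE6.lean`, whose members are the traces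
of the interface loops `IsSiteInterfaceLoop`) and the arm-separation route of Nolin 2008 /
Schramm–Steif 2010 (named fact `Nolin2008_twoArm_separation`, whose blueprint
`ArmSeparationScheme.lean` starts from "interfaces crossing `Λ_R ∖ Λ̊_r`"): **the polychromatic
two-arm event `armEvent (open, closed) r R` of the hexagonal annulus `Λ_R ∖ Λ̊_r` holds iff a
percolation interface — a path of the hexagonal lattice with an open site on the left and a
closed site on the right of every dart — crosses the annulus**, up to one lattice spacing at
each end (Smirnov–Werner 2001, §4, Remark 6 and (15): the hull of the annulus exploration
process at the hitting time of the inner circle "is bounded by two crossings of the annulus: the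
clockwise-most blue crossing and the counterclockwise-most yellow crossing", so `b_j^{ep} ≤ b_j`,
and for even `j` conversely "the starting point of the exploration process is anyway between two
crossings of different colours"; Camia–Newman, Comm. Math. Phys. 268 (2006), §4; Nolin 2008,
§4.1, `σ = BW`).

* `mem_armEvent_two_of_interfaceWalk` — **interface ⇒ arms**: an interface walk of `ω` from a
  face with a vertex in `Λ_r` to a face with a vertex off `Λ̊_R` gives
  `ω ∈ armEvent ![true, false] (r+1) (R-1)` (its left sites are an open chain, its right sites a
  closed chain, `interfaceDartSeq_pathIn_fst/snd`; trimmed to arms by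
  `PathIn.exists_arm_of_triNorm_le`); loop forms `IsSiteInterfaceLoop.mem_armEvent_two`,
  `IsSiteInterfaceLoop.mem_armEvent_two_of_polyTrace` (trace within one mesh of `δΛ_r` and of
  `δ(Λ̊_R)ᶜ` ⇒ `armEvent ![true, false] (r+3) (R-3)`).
* `exists_interfaceWalk_of_mem_armEvent_two` — **arms ⇒ interface**: if
  `ω ∈ armEvent ![true, false] r R` (`1 ≤ r ≤ R`) there is an interface walk of `ω` all of whose
  crossed edges lie in the closed annulus `{r ≤ |·|_𝕋 ≤ R}`, from a face with a vertex on
  `∂Λ_{r-1}` to a face with a vertex on `∂Λ_{R+1}`; for configurations with finitely many open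
  sites (the restricted configurations of `triLoopCollection`) it lies on an interface loop
  (`exists_isSiteInterfaceLoop_of_interfaceWalk`, `exists_isSiteInterfaceLoop_of_mem_armEvent_two`),
  whose polygonal trace at mesh `δ` comes within `δ` of `δ∂Λ_{r-1}` and of `δ∂Λ_{R+1}`
  (`exists_isSiteInterfaceLoop_polyTrace_of_mem_armEvent_two`).

Proof of "arms ⇒ interface" (no Jordan curve theorem; the planar input is the winding-number
jump of `SiteInterfaceWinding.lean`, as in `MacroscopicInterfaceLoop.lean`). Modify `ω` off the
annulus: `ω₁` is open on `Λ̊_r`, equals `ω` on the annulus and is closed off `Λ_R`. Let the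
closed arm start at `x₁ ∈ ∂Λ_r` and let `s₁ ∼ x₁` have norm `r - 1`. Through the dart `s₁ → x₁`
passes an interface loop `w` of `ω₁` (`exists_isSiteInterfaceLoop_of_adj`); its polygon winds
once more about `s₁` than about `x₁` (`loopWind_leftPt_sub_loopWind_rightPt`). Winding numbers
are constant along open chains and along closed chains not crossed by `w`
(`loopWind_triMeshPoint_eq_of_chain`) and vanish far away: along the closed arm and an outward
closed chain, `wind x₁ = 0`; through the open ball, the open arm and its endpoint
`y₀ ∈ ∂Λ_R`, `wind y₀ = wind s₁ = 1`; an outward neighbour `z₀` of `y₀` has `wind z₀ = 0`.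
Hence `w` crosses the edge `y₀ z₀` (`loopWind_triMeshPoint_eq_of_adj`), and the stretch of `w`
between its last step before this crossing touching `Λ̊_r` and its first step leaving `Λ_R`
crosses only annulus edges, on which `ω₁ = ω`.

Everything is proved; no definitions and no named facts are introduced (interface walks are
carried as a walk `p` of `hexGraph` with a dart sequence `e : ℕ → triGraph.Dart`,
`triEdgeFaces (e i) = (p.getVert (i+1), p.getVert i)`, `(e i).fst ∈ ω`, `(e i).snd ∉ ω`, the
indexed form of the dart condition of `IsSiteInterfaceLoop`, `interfaceDarts_iff_getVert`).

## References

* S. Smirnov, W. Werner, Math. Res. Lett. 8 (2001) 729–744, §4, Remark 6, (15), (16)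
  [SmirnovWernerMRL2001].
* F. Camia, C. M. Newman, Comm. Math. Phys. 268 (2006), §4 [CamiaNewman2006].
* B. Bollobás, O. Riordan, *Percolation* (2006), Ch. 7 p. 178 (the interface graph)
  [BollobasRiordan2006].
* P. Nolin, Electron. J. Probab. 13 (2008), §4.1 [Nolin2008].
-/

noncomputable section

open Set Metric Complex Filter MeasureTheory
open Literature.Topology.PlaneTopology Literature.Probability.RandomPlanarGeometry
open scoped unitInterval Topology

namespace Literature.Probability.Percolation

open LatticeModels

/-! ### Lattice preliminaries -/

/-- **Ascent**: every site of `𝕋` has a neighbour whose graph norm is larger by one (move along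
`± e₀` or `± e₁` according to which of `|x₀|, |x₁|, |x₀ + x₁|` realises the norm and its sign).
[folklore] -/
theorem exists_triGraph_adj_triNorm_eq_add_one (x : Site 2) :
    ∃ y, triGraph.Adj x y ∧ triNorm y = triNorm x + 1 := by
  have hx := triNorm_eq_of_apply_eq (y := x) rfl rfl
  rcases le_or_gt 0 (x 0) with h0 | h0 <;> rcases le_or_gt 0 (x 0 + x 1) with h1 | h1
  · refine ⟨x + Pi.single 0 1, triGraph_adj_self_add_single x 0, ?_⟩
    rw [hx, triNorm_eq_of_apply_eq (y := x + Pi.single 0 1) (a := x 0 + 1) (b := x 1) (by simp) (by simp)]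
    omega
  · refine ⟨x - Pi.single 1 1, triGraph_adj_self_sub_single x 1, ?_⟩
    rw [hx, triNorm_eq_of_apply_eq (y := x - Pi.single 1 1) (a := x 0) (b := x 1 - 1) (by simp) (by simp)]
    omega
  · refine ⟨x + Pi.single 1 1, triGraph_adj_self_add_single x 1, ?_⟩
    rw [hx, triNorm_eq_of_apply_eq (y := x + Pi.single 1 1) (a := x 0) (b := x 1 + 1) (by simp) (by simp)]
    omega
  · refine ⟨x - Pi.single 0 1, triGraph_adj_self_sub_single x 0, ?_⟩
    rw [hx, triNorm_eq_of_apply_eq (y := x - Pi.single 0 1) (a := x 0 - 1) (b := x 1) (by simp) (by simp)]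
    omega

/-- Two vertices of one face of `𝕋` have graph norms differing by at most one (they are equal or
adjacent). [folklore] -/
theorem triNorm_le_of_mem_hexFaceVertices {F : HexVertex} {a b : Site 2} (ha : a ∈ hexFaceVertices F)
    (hb : b ∈ hexFaceVertices F) : triNorm b ≤ triNorm a + 1 := by
  by_cases h : a = b
  · subst h; omega
  · exact triNorm_le_triNorm_add_one_of_adj (adj_of_mem_hexFaceVertices ha hb h)

/-- **The two sites of a dart of `𝕋` are vertices of both bordering faces.** [folklore] -/
theorem mem_hexFaceVertices_of_triEdgeFaces {u v : Site 2} (h : triGraph.Adj u v) {L R : HexVertex}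
    (he : triEdgeFaces ⟨(u, v), h⟩ = (L, R)) :
    u ∈ hexFaceVertices R ∧ v ∈ hexFaceVertices R ∧ u ∈ hexFaceVertices L ∧ v ∈ hexFaceVertices L := by
  obtain ⟨J, h1, hv, hu⟩ := exists_sideIdx_of_triEdgeFaces h
  rw [he] at h1 hv hu
  dsimp only at h1 hv hu
  refine ⟨hu ▸ faceVertex_mem R (J + 2), hv ▸ faceVertex_mem R (J + 1), ?_, ?_⟩
  · rw [h1, hu, ← faceVertex_oppFace_succ]; exact faceVertex_mem _ _
  · rw [h1, hv, ← faceVertex_oppFace_succ_succ]; exact faceVertex_mem _ _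

/-- **Outward chains.** If every site of norm `> M` lies in `S`, a site `v` of norm `> M` is
joined inside `S` to sites of every larger norm. [folklore] -/
theorem exists_pathIn_triNorm_eq_add {S : Set (Site 2)} {M : ℤ} (hS : ∀ u, M < triNorm u → u ∈ S)
    {v : Site 2} (hv : M < triNorm v) :
    ∀ k : ℕ, ∃ u, triNorm u = triNorm v + k ∧ PathIn triGraph S v u
  | 0 => ⟨v, by simp, PathIn.refl (hS v hv)⟩
  | k + 1 => by
    obtain ⟨u, hu, hp⟩ := exists_pathIn_triNorm_eq_add hS hv k
    obtain ⟨u', huu', hu'⟩ := exists_triGraph_adj_triNorm_eq_add_one u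
    refine ⟨u', by rw [hu', hu]; push_cast; ring, hp.tail huu' (hS u' ?_)⟩
    rw [hu', hu]; have := triNorm_nonneg v; omega

/-- **Inward chains.** If every site of norm `< m` lies in `S`, every site of norm `< m` is joined
inside `S` to the origin (descend along `exists_triGraph_adj_triNorm_add_one_eq`). [folklore] -/
theorem pathIn_zero_of_triNorm_lt {S : Set (Site 2)} {m : ℤ} (hS : ∀ u, triNorm u < m → u ∈ S) :
    ∀ (n : ℕ) (v : Site 2), triNorm v = n → (n : ℤ) < m → PathIn triGraph S v 0
  | 0, v, hv, hm => by
    obtain rfl : v = 0 := eq_zero_of_triNorm_eq_zero (by exact_mod_cast hv)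
    exact PathIn.refl (hS 0 (by simpa using hm))
  | n + 1, v, hv, hm => by
    have hv0 : v ≠ 0 := by rintro rfl; simp at hv; omega
    obtain ⟨y, hvy, hy⟩ := exists_triGraph_adj_triNorm_add_one_eq hv0
    have hyn : triNorm y = n := by push_cast at hv; omega
    exact (PathIn.of_adj (hS v (by omega)) (hS y (by omega)) hvy).trans
      (pathIn_zero_of_triNorm_lt hS n y hyn (by push_cast at hm; omega))

/-! ### Interface walks: the sites on the two sides -/

section Walk

variable {ω : SiteConfig (Site 2)} {F G : HexVertex} {p : hexGraph.Walk F G} {e : ℕ → triGraph.Dart}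

/-- The dart condition of `IsSiteInterfaceLoop` (stated for all darts of a walk) in indexed
form: for every step `i` some dart of `𝕋` with open tail and closed head has left face the
`(i+1)`-st and right face the `i`-th face. [folklore] -/
theorem interfaceDarts_iff_getVert :
    (∀ d ∈ p.darts, ∃ e : triGraph.Dart, triEdgeFaces e = (d.snd, d.fst) ∧ e.fst ∈ ω ∧ e.snd ∉ ω) ↔
    (∀ i < p.length, ∃ e : triGraph.Dart, triEdgeFaces e = (p.getVert (i + 1), p.getVert i) ∧ e.fst ∈ ω ∧ e.snd ∉ ω) := by
  constructor
  · intro h i hi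
    have hi' : i < p.darts.length := by rw [SimpleGraph.Walk.length_darts]; exact hi
    have := h _ (List.getElem_mem hi')
    rw [SimpleGraph.Walk.darts_getElem_eq_getVert i hi'] at this
    exact this
  · intro h d hd
    obtain ⟨i, hi, rfl⟩ := List.getElem_of_mem hd
    rw [SimpleGraph.Walk.darts_getElem_eq_getVert i hi]
    exact h i (by rwa [SimpleGraph.Walk.length_darts] at hi)

/-- Choosing the crossed darts: the indexed dart condition yields a dart sequence. [folklore] -/
theorem exists_interfaceDartSeq
    (h : ∀ i < p.length, ∃ e : triGraph.Dart, triEdgeFaces e = (p.getVert (i + 1), p.getVert i) ∧ e.fst ∈ ω ∧ e.snd ∉ ω)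
    (hlen : 0 < p.length) :
    ∃ e : ℕ → triGraph.Dart, ∀ i < p.length,
      triEdgeFaces (e i) = (p.getVert (i + 1), p.getVert i) ∧ (e i).fst ∈ ω ∧ (e i).snd ∉ ω := by
  classical
  obtain ⟨e₀, he₀⟩ := h 0 hlen
  refine ⟨fun i => if hi : i < p.length then (h i hi).choose else e₀, fun i hi => ?_⟩
  simp only [dif_pos hi]
  exact (h i hi).choose_spec

variable (he : ∀ i < p.length, triEdgeFaces (e i) = (p.getVert (i + 1), p.getVert i) ∧ (e i).fst ∈ ω ∧ (e i).snd ∉ ω)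
include he

/-- The tail (open, left) site of the `i`-th crossed dart is a vertex of the `i`-th face and of
the `(i+1)`-st face; likewise the head (closed, right) site. [folklore] -/
theorem interfaceDartSeq_mem_hexFaceVertices {i : ℕ} (hi : i < p.length) :
    (e i).fst ∈ hexFaceVertices (p.getVert i) ∧ (e i).snd ∈ hexFaceVertices (p.getVert i) ∧
      (e i).fst ∈ hexFaceVertices (p.getVert (i + 1)) ∧ (e i).snd ∈ hexFaceVertices (p.getVert (i + 1)) := by
  have h := (he i hi).1
  have : e i = ⟨((e i).fst, (e i).snd), (e i).adj⟩ := rfl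
  rw [this] at h
  exact mem_hexFaceVertices_of_triEdgeFaces (e i).adj h

/-- **The open sites on the left of an interface walk form a chain**: the tail of the first
crossed dart is joined by open sites to the tail of every later one (consecutive ones are
vertices of a common face, hence equal or adjacent). [folklore] -/
theorem interfaceDartSeq_pathIn_fst : ∀ {j : ℕ}, j < p.length → PathIn triGraph ω (e 0).fst (e j).fst
  | 0, hj => PathIn.refl (he 0 hj).2.1
  | j + 1, hj => by
    refine (interfaceDartSeq_pathIn_fst (j := j) (by omega)).trans
      (PathIn.of_eq_or_adj (he j (by omega)).2.1 (he (j + 1) hj).2.1 ?_)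
    by_cases h : (e j).fst = (e (j + 1)).fst
    · exact Or.inl h
    · exact Or.inr (adj_of_mem_hexFaceVertices (interfaceDartSeq_mem_hexFaceVertices he (by omega)).2.2.1
        (interfaceDartSeq_mem_hexFaceVertices he hj).1 h)

/-- **The closed sites on the right of an interface walk form a chain.** [folklore] -/
theorem interfaceDartSeq_pathIn_snd : ∀ {j : ℕ}, j < p.length → PathIn triGraph ωᶜ (e 0).snd (e j).snd
  | 0, hj => PathIn.refl (he 0 hj).2.2
  | j + 1, hj => by
    refine (interfaceDartSeq_pathIn_snd (j := j) (by omega)).trans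
      (PathIn.of_eq_or_adj (he j (by omega)).2.2 (he (j + 1) hj).2.2 ?_)
    by_cases h : (e j).snd = (e (j + 1)).snd
    · exact Or.inl h
    · exact Or.inr (adj_of_mem_hexFaceVertices (interfaceDartSeq_mem_hexFaceVertices he (by omega)).2.2.2
        (interfaceDartSeq_mem_hexFaceVertices he hj).2.1 h)

end Walk

/-! ### An interface walk across the annulus gives the two arms -/

/-- A closed arm is an open arm of the complementary configuration. [folklore] -/
theorem mem_armEvent_false_iff_compl {r R : ℕ} {ω : SiteConfig (Site 2)} :
    ω ∈ armEvent ![false] r R ↔ ωᶜ ∈ armEvent ![true] r R := by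
  have h := compl_preimage_armEvent ![true] r R
  have e : (fun j => !(![true] : Fin 1 → Bool) j) = ![false] := funext fun j => by fin_cases j; rfl
  rw [e] at h
  rw [← h]; rfl

/-- **An interface walk across the annulus realises the polychromatic two-arm event.** If a walk
of the hexagonal lattice, every dart of which crosses an edge of `𝕋` with an open site on its
left and a closed site on its right (in `ω`), starts at a face with a vertex of norm `≤ r` and
ends at a face with a vertex of norm `≥ R` (`r + 2 ≤ R`), then `ω ∈ armEvent (open, closed)
(r+1) (R-1)`: the open sites on its left and the closed sites on its right are two chains of
`𝕋` from `Λ_{r+1}` to `∂Λ_{R-1}` and beyond, trimmed to arms (Smirnov–Werner 2001, §4, proof of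
(15): "`b_j^{ep} ≤ b_j`" — the two sides of a crossing interface are arms of the two colours;
Camia–Newman 2006, §4). [cite: SmirnovWernerMRL2001, §4 Remark 6 and (15)] -/
theorem mem_armEvent_two_of_interfaceWalk {ω : SiteConfig (Site 2)} {F G : HexVertex} (p : hexGraph.Walk F G)
    (e : ℕ → triGraph.Dart)
    (he : ∀ i < p.length, triEdgeFaces (e i) = (p.getVert (i + 1), p.getVert i) ∧ (e i).fst ∈ ω ∧ (e i).snd ∉ ω)
    {r R : ℕ} (hrR : r + 2 ≤ R) (hF : ∃ v ∈ hexFaceVertices F, triNorm v ≤ r)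
    (hG : ∃ v ∈ hexFaceVertices G, (R : ℤ) ≤ triNorm v) :
    ω ∈ armEvent ![true, false] (r + 1) (R - 1) := by
  obtain ⟨a, ha, har⟩ := hF
  obtain ⟨b, hb, hbR⟩ := hG
  -- the walk is not trivial
  have hlen : 0 < p.length := by
    by_contra h0
    have h0' : p.length = 0 := by omega
    have hFG : F = G := by
      have := p.getVert_of_length_le (le_of_eq h0')
      rw [← this, SimpleGraph.Walk.getVert_zero]
    subst hFG
    have := triNorm_le_of_mem_hexFaceVertices ha hb
    omega
  set n := p.length with hn
  have hG' : p.getVert n = G := p.getVert_length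
  -- norms of the first and last crossed darts
  have h0 := interfaceDartSeq_mem_hexFaceVertices he hlen
  have hl := interfaceDartSeq_mem_hexFaceVertices he (i := n - 1) (by omega)
  rw [show n - 1 + 1 = n by omega, hG'] at hl
  rw [SimpleGraph.Walk.getVert_zero] at h0
  have h0f : triNorm (e 0).fst ≤ r + 1 := by have := triNorm_le_of_mem_hexFaceVertices ha h0.1; omega
  have h0s : triNorm (e 0).snd ≤ r + 1 := by have := triNorm_le_of_mem_hexFaceVertices ha h0.2.1; omega
  have hlf : ((R - 1 : ℕ) : ℤ) ≤ triNorm (e (n - 1)).fst := by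
    have := triNorm_le_of_mem_hexFaceVertices hl.2.2.1 hb; push_cast [show 1 ≤ R by omega]; omega
  have hls : ((R - 1 : ℕ) : ℤ) ≤ triNorm (e (n - 1)).snd := by
    have := triNorm_le_of_mem_hexFaceVertices hl.2.2.2 hb; push_cast [show 1 ≤ R by omega]; omega
  have hrR' : r + 1 ≤ R - 1 := by omega
  rw [armEvent_two_eq_inter]
  refine ⟨?_, ?_⟩
  · exact mem_armEvent_one_of_pathIn (interfaceDartSeq_pathIn_fst he (j := n - 1) (by omega))
      (by exact_mod_cast h0f) hlf hrR'
  · rw [mem_armEvent_false_iff_compl]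
    exact mem_armEvent_one_of_pathIn (interfaceDartSeq_pathIn_snd he (j := n - 1) (by omega))
      (by exact_mod_cast h0s) hls hrR'

/-! ### Winding-number transport along coloured paths -/

section Transport

variable {ω : SiteConfig (Site 2)} {f₀ : HexVertex} {w : hexGraph.Walk f₀ f₀} (hw : IsSiteInterfaceLoop ω w)
  {δ : ℝ} (hδ : 0 < δ)

/-- The trace of a closed lattice polygon is bounded. [folklore] -/
theorem exists_polyTrace_subset_closedBall (hlen : 0 < w.length) (δ : ℝ) :
    ∃ ρ : ℝ, polyTrace δ w ⊆ closedBall 0 ρ := by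
  have hb : Bornology.IsBounded (polyTrace δ w) := by
    rw [← range_loopPath hlen]
    exact (isCompact_range (loopPath δ w).continuous).isBounded
  exact hb.subset_closedBall 0

include hw hδ

/-- **Transport along open paths**: the interface polygon winds equally about the mesh points of
two sites joined by a path of open sites (no open–open edge is crossed). [folklore] -/
theorem IsSiteInterfaceLoop.loopWind_eq_of_pathIn {A : Set (Site 2)} (hA : A ⊆ ω) {u v : Site 2}
    (h : PathIn triGraph A u v) : loopWind δ w (triMeshPoint δ u) = loopWind δ w (triMeshPoint δ v) := by
  obtain ⟨q, hq⟩ := h.exists_walk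
  have := hw.loopWind_triMeshPoint_eq_of_chain hδ q.getVert q.length
    (fun k hk ↦ Or.inr (q.adj_getVert_succ hk))
    (fun k _ j hj ↦ ⟨fun hh ↦ hw.rv_not_mem hj (hh.2 ▸ hA (hq _ (q.getVert_mem_support (k + 1)))),
      fun hh ↦ hw.rv_not_mem hj (hh.1 ▸ hA (hq _ (q.getVert_mem_support k)))⟩)
  rwa [SimpleGraph.Walk.getVert_zero, SimpleGraph.Walk.getVert_length] at this

/-- **Transport along closed paths**: likewise for two sites joined by a path of closed sites.
[folklore] -/
theorem IsSiteInterfaceLoop.loopWind_eq_of_pathIn_compl {A : Set (Site 2)} (hA : A ⊆ ωᶜ) {u v : Site 2}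
    (h : PathIn triGraph A u v) : loopWind δ w (triMeshPoint δ u) = loopWind δ w (triMeshPoint δ v) := by
  obtain ⟨q, hq⟩ := h.exists_walk
  have := hw.loopWind_triMeshPoint_eq_of_chain hδ q.getVert q.length
    (fun k hk ↦ Or.inr (q.adj_getVert_succ hk))
    (fun k _ j hj ↦ ⟨fun hh ↦ hA (hq _ (q.getVert_mem_support k)) (hh.1 ▸ hw.lv_mem hj),
      fun hh ↦ hA (hq _ (q.getVert_mem_support (k + 1))) (hh.2 ▸ hw.lv_mem hj)⟩)
  rwa [SimpleGraph.Walk.getVert_zero, SimpleGraph.Walk.getVert_length] at this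

omit hw in
/-- The interface polygon does not wind about mesh points far from the origin. [folklore] -/
theorem loopWind_triMeshPoint_eq_zero_of_lt_norm (hlen : 0 < w.length) {ρ : ℝ}
    (hsub : polyTrace δ w ⊆ closedBall 0 ρ) {v : Site 2} (hv : ρ < δ * ‖triEmbed v‖) :
    loopWind δ w (triMeshPoint δ v) = 0 :=
  loopWind_eq_zero_of_lt_dist hlen hsub (by rwa [← triMeshPoint_zero δ, dist_triMeshPoint_eq hδ.le, sub_zero])

end Transport

/-! ### Two arms give an interface walk across the annulus -/

/-- **A polychromatic two-arm crossing forces an interface across the annulus.** If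
`ω ∈ armEvent (open, closed) r R` (`1 ≤ r ≤ R`), there is a walk of the hexagonal lattice every
dart of which crosses an edge of `𝕋` with an open site of `ω` on its left and a closed site on
its right, all these sites lying in the closed annulus `{r ≤ |·|_𝕋 ≤ R}`, from a face with a
vertex on `∂Λ_{r-1}` to a face with a vertex on `∂Λ_{R+1}` (the converse of
`mem_armEvent_two_of_interfaceWalk` up to one lattice spacing; Smirnov–Werner 2001, §4 (15),
`j = 2`: "for even `j`, `b_j ≤ const b_j^{ep}`" — a polychromatic crossing is bounded by an
interface; Camia–Newman 2006, §4; Nolin 2008, §4.1 and Schramm–Steif 2010, App. A: two-arm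
events of alternating colours are interface crossings).

Proof (Jordan-curve-free). Modify `ω` off the annulus: `ω₁` is open on `Λ̊_r`, equal to `ω` on
the annulus and closed off `Λ_R` (finitely many open sites). Let `x₁ ∈ ∂Λ_r` start the closed arm
and `s₁ ∼ x₁` have norm `r - 1`; through the dart `s₁ → x₁` passes an interface loop `w` of `ω₁`
(`exists_isSiteInterfaceLoop_of_adj`). Its polygon winds once more about `s₁` than about `x₁`
(`loopWind_leftPt_sub_loopWind_rightPt`); the winding number is transported along the closed arm
and an outward closed chain to a far site (value `0`), and from `s₁` through the open ball
`Λ̊_r`, the open arm and its endpoint `y₀ ∈ ∂Λ_R` (value `1`), while an outward neighbour `z₀`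
of `y₀` again has value `0`: so `w` crosses the edge `y₀ z₀`
(`loopWind_triMeshPoint_eq_of_adj`). Between the last step before that crossing which touches
`Λ̊_r` and the first step after it which leaves `Λ_R`, all crossed edges lie in the annulus,
where `ω₁ = ω`. [cite: SmirnovWernerMRL2001, §4 Remark 6 and (15)] -/
theorem exists_interfaceWalk_of_mem_armEvent_two {ω : SiteConfig (Site 2)} {r R : ℕ} (hr : 1 ≤ r) (hrR : r ≤ R)
    (hω : ω ∈ armEvent ![true, false] r R) :
    ∃ (F G : HexVertex) (p : hexGraph.Walk F G) (e : ℕ → triGraph.Dart),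
      (∀ i < p.length, triEdgeFaces (e i) = (p.getVert (i + 1), p.getVert i) ∧ (e i).fst ∈ ω ∧ (e i).snd ∉ ω) ∧
      (∀ i < p.length, (r : ℤ) ≤ triNorm (e i).fst ∧ triNorm (e i).fst ≤ R ∧
        (r : ℤ) ≤ triNorm (e i).snd ∧ triNorm (e i).snd ≤ R) ∧
      (∃ v ∈ hexFaceVertices F, triNorm v + 1 = r) ∧ (∃ v ∈ hexFaceVertices G, triNorm v = R + 1) := by
  classical
  -- the two arms
  rw [armEvent_two_eq_inter] at hω
  obtain ⟨x₀, hx₀, y₀, hy₀, hPo⟩ := (mem_armEvent_one_iff_exists_pathIn (c := true) hrR).1 hω.1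
  obtain ⟨x₁, hx₁, y₁, hy₁, hPc⟩ := (mem_armEvent_one_iff_exists_pathIn (c := false) hrR).1 hω.2
  rw [mem_triSphere_iff] at hx₀ hy₀ hx₁ hy₁
  -- the modified configuration: open inside `Λ̊_r`, `ω` on the annulus, closed off `Λ_R`
  set ω₁ : SiteConfig (Site 2) := {v | triNorm v < r ∨ (v ∈ ω ∧ triNorm v ≤ R)} with hω₁
  have hin : ∀ v, triNorm v < r → v ∈ ω₁ := fun v hv ↦ Or.inl hv
  have hout : ∀ v, (R : ℤ) < triNorm v → v ∈ ω₁ᶜ := fun v hv h ↦ by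
    rcases h with h | h <;> omega
  have hfin : ω₁.Finite := (triBall R).finite_toSet.subset fun v hv ↦ by
    rcases hv with hv | hv
    · exact Finset.mem_coe.2 (mem_triBall_iff.2 (by omega))
    · exact Finset.mem_coe.2 (mem_triBall_iff.2 hv.2)
  -- the arms inside `ω₁`
  have hPo' : PathIn triGraph ω₁ x₀ y₀ := hPo.mono fun v hv ↦ Or.inr ⟨hv.2.2 rfl, hv.1.2⟩
  have hPc' : PathIn triGraph ω₁ᶜ x₁ y₁ := hPc.mono fun v hv h ↦ by
    rcases h with h | h
    · exact absurd hv.1.1 (not_le.2 h)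
    · exact Bool.false_ne_true (hv.2.1 h.1)
  -- inward neighbours of the starting points, outward neighbours of the endpoints
  have hx₁0 : x₁ ≠ 0 := by rintro rfl; rw [triNorm_zero] at hx₁; omega
  have hx₀0 : x₀ ≠ 0 := by rintro rfl; rw [triNorm_zero] at hx₀; omega
  obtain ⟨s₁, hxs₁, hs₁⟩ := exists_triGraph_adj_triNorm_add_one_eq hx₁0
  obtain ⟨s₀, hxs₀, hs₀⟩ := exists_triGraph_adj_triNorm_add_one_eq hx₀0
  obtain ⟨z₀, hyz₀, hz₀⟩ := exists_triGraph_adj_triNorm_eq_add_one y₀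
  obtain ⟨z₁, hyz₁, hz₁⟩ := exists_triGraph_adj_triNorm_eq_add_one y₁
  have hs₁ω : s₁ ∈ ω₁ := hin _ (by omega)
  have hx₁ω : x₁ ∉ ω₁ := hPc'.left_mem
  -- the interface loop of `ω₁` through the dart `s₁ → x₁`
  obtain ⟨F₀, w, hw, hfaces⟩ := exists_isSiteInterfaceLoop_of_adj hfin hxs₁.symm hs₁ω hx₁ω
  have hlen : 0 < w.length := by have := hw.isCycle.three_le_length; omega
  have hlr : hw.lv 0 = s₁ ∧ hw.rv 0 = x₁ := by
    obtain ⟨h', hfaces', -, -⟩ := hw.dart_spec hlen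
    exact eq_of_triEdgeFaces_eq h' hxs₁.symm (hfaces'.trans hfaces.symm)
  -- winding numbers of the interface polygon at mesh `1` about the sites
  obtain ⟨ρ, hρ⟩ := exists_polyTrace_subset_closedBall hlen (1 : ℝ)
  have hWout : ∀ v, (R : ℤ) < triNorm v → loopWind 1 w (triMeshPoint 1 v) = 0 := by
    intro v hv
    obtain ⟨k, hk⟩ := exists_nat_gt (2 * ρ)
    obtain ⟨u, hu, hp⟩ := exists_pathIn_triNorm_eq_add hout hv k
    have hWu : loopWind 1 w (triMeshPoint 1 u) = 0 := by
      refine loopWind_triMeshPoint_eq_zero_of_lt_norm one_pos hlen hρ ?_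
      have h1 := mul_triNorm_le_norm_triEmbed u
      have h2 : (k : ℝ) ≤ triNorm u := by
        have : (k : ℤ) ≤ triNorm u := by rw [hu]; have := triNorm_nonneg v; omega
        exact_mod_cast this
      have h3 : (1 : ℝ) ≤ Real.sqrt 3 := Real.one_le_sqrt.2 (by norm_num)
      have h4 : (0 : ℝ) ≤ triNorm u := by exact_mod_cast triNorm_nonneg u
      nlinarith
    rw [← hWu]
    exact hw.loopWind_eq_of_pathIn_compl one_pos subset_rfl hp
  -- the closed arm has winding number `0`
  have hWx₁ : loopWind 1 w (triMeshPoint 1 x₁) = 0 := by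
    rw [hw.loopWind_eq_of_pathIn_compl one_pos subset_rfl hPc',
      hw.loopWind_triMeshPoint_eq_of_not_mem one_pos (Or.inr hyz₁) hPc'.right_mem (hout z₁ (by omega))]
    exact hWout z₁ (by omega)
  -- the open side has winding number `1`
  have hjump := hw.loopWind_leftPt_sub_loopWind_rightPt one_pos hlen
  rw [IsSiteInterfaceLoop.leftPt, IsSiteInterfaceLoop.rightPt, hlr.1, hlr.2, hWx₁] at hjump
  have hWs₁ : loopWind 1 w (triMeshPoint 1 s₁) = 1 := by omega
  have hWy₀ : loopWind 1 w (triMeshPoint 1 y₀) = 1 := by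
    rw [← hWs₁, hw.loopWind_eq_of_pathIn one_pos subset_rfl
        (pathIn_zero_of_triNorm_lt hin (r - 1) s₁ (by push_cast [hr]; omega) (by push_cast [hr]; omega)),
      ← hw.loopWind_eq_of_pathIn one_pos subset_rfl
        (pathIn_zero_of_triNorm_lt hin (r - 1) s₀ (by push_cast [hr]; omega) (by push_cast [hr]; omega)),
      hw.loopWind_triMeshPoint_eq_of_mem one_pos (Or.inr hxs₀.symm) (hin s₀ (by omega)) hPo'.left_mem,
      hw.loopWind_eq_of_pathIn one_pos subset_rfl hPo']
  have hWz₀ : loopWind 1 w (triMeshPoint 1 z₀) = 0 := hWout z₀ (by omega)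
  -- so the loop crosses the edge `y₀ z₀`
  have hcross : ∃ i < w.length, hw.lv i = y₀ ∧ hw.rv i = z₀ := by
    by_contra hno
    push Not at hno
    have := hw.loopWind_triMeshPoint_eq_of_adj one_pos (Or.inr hyz₀) fun i hi ↦
      ⟨fun hh ↦ hno i hi hh.1.symm hh.2.symm, fun hh ↦ hout z₀ (by omega) (hh.2 ▸ hw.lv_mem hi)⟩
    rw [hWy₀, hWz₀] at this
    exact zero_ne_one this.symm
  obtain ⟨i, hi, hli, hri⟩ := hcross
  -- the first step leaving `Λ_R`, and the last step before it touching `Λ̊_r`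
  have hex : ∃ j, (R : ℤ) < triNorm (hw.lv j) ∨ (R : ℤ) < triNorm (hw.rv j) := ⟨i, Or.inr (by rw [hri]; omega)⟩
  set j₂ := Nat.find hex with hj₂
  have hj₂spec : (R : ℤ) < triNorm (hw.lv j₂) ∨ (R : ℤ) < triNorm (hw.rv j₂) := Nat.find_spec hex
  have hj₂min : ∀ j < j₂, ¬ ((R : ℤ) < triNorm (hw.lv j) ∨ (R : ℤ) < triNorm (hw.rv j)) := fun j hj ↦
    Nat.find_min hex hj
  have hj₂i : j₂ ≤ i := Nat.find_min' hex (Or.inr (by rw [hri]; omega))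
  have hj₂pos : 0 < j₂ := by
    rw [Nat.pos_iff_ne_zero]
    intro h0
    have h := hj₂spec
    rw [h0, hlr.1, hlr.2] at h
    omega
  set j₁ := Nat.findGreatest (fun j ↦ triNorm (hw.lv j) < r ∨ triNorm (hw.rv j) < r) (j₂ - 1) with hj₁
  have hj₁le : j₁ ≤ j₂ - 1 := Nat.findGreatest_le _
  have hj₁spec : triNorm (hw.lv j₁) < r ∨ triNorm (hw.rv j₁) < r :=
    Nat.findGreatest_spec (P := fun j ↦ triNorm (hw.lv j) < r ∨ triNorm (hw.rv j) < r) (Nat.zero_le _)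
      (Or.inl (by rw [hlr.1]; omega))
  have hj₁max : ∀ j, j₁ < j → j ≤ j₂ - 1 → ¬ (triNorm (hw.lv j) < r ∨ triNorm (hw.rv j) < r) :=
    fun j h1 h2 ↦ Nat.findGreatest_is_greatest h1 h2
  have hann : ∀ j, j₁ < j → j < j₂ → (r : ℤ) ≤ triNorm (hw.lv j) ∧ triNorm (hw.lv j) ≤ R ∧
      (r : ℤ) ≤ triNorm (hw.rv j) ∧ triNorm (hw.rv j) ≤ R := by
    intro j h1 h2
    have a := hj₁max j h1 (by omega)
    have b := hj₂min j h2
    push Not at a b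
    exact ⟨a.1, b.1, a.2, b.2⟩
  have hj₂len : j₂ < w.length := by omega
  -- the interface walk: steps `j₁ + 1, …, j₂ - 1` of `w`
  set m := j₂ - 1 - j₁ with hm
  have hGv : (w.drop (j₁ + 1)).getVert m = w.getVert j₂ := by
    rw [SimpleGraph.Walk.drop_getVert]; congr 1; omega
  set p : hexGraph.Walk (w.getVert (j₁ + 1)) (w.getVert j₂) := ((w.drop (j₁ + 1)).take m).copy rfl hGv with hp
  have hplen : p.length = m := by
    rw [hp, SimpleGraph.Walk.length_copy, SimpleGraph.Walk.take_length, SimpleGraph.Walk.drop_length]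
    omega
  have hpget : ∀ k ≤ m, p.getVert k = w.getVert (j₁ + 1 + k) := by
    intro k hk
    rw [hp, SimpleGraph.Walk.getVert_copy, SimpleGraph.Walk.take_getVert, SimpleGraph.Walk.drop_getVert,
      min_eq_right hk]
  set e : ℕ → triGraph.Dart := fun k ↦ if h : j₁ + 1 + k < w.length then
    ⟨(hw.lv (j₁ + 1 + k), hw.rv (j₁ + 1 + k)), hw.adj_lv_rv h⟩ else ⟨(hw.lv 0, hw.rv 0), hw.adj_lv_rv hlen⟩ with he
  have hek : ∀ (k : ℕ) (hk : k < m), e k = ⟨(hw.lv (j₁ + 1 + k), hw.rv (j₁ + 1 + k)), hw.adj_lv_rv (by omega)⟩ := by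
    intro k hk
    simp only [he, dif_pos (show j₁ + 1 + k < w.length by omega)]
  refine ⟨w.getVert (j₁ + 1), w.getVert j₂, p, e, ?_, ?_, ?_, ?_⟩
  · intro k hk
    rw [hplen] at hk
    have hJ : j₁ + 1 + k < w.length := by omega
    obtain ⟨h', hf, hl, hr'⟩ := hw.dart_spec hJ
    obtain ⟨a1, a2, a3, a4⟩ := hann (j₁ + 1 + k) (by omega) (by omega)
    rw [hek k hk, hpget k (by omega), hpget (k + 1) (by omega)]
    refine ⟨?_, ?_, ?_⟩
    · rw [show j₁ + 1 + (k + 1) = j₁ + 1 + k + 1 by omega]; exact hf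
    · change hw.lv (j₁ + 1 + k) ∈ ω
      rcases hl with hl | hl
      · omega
      · exact hl.1
    · change hw.rv (j₁ + 1 + k) ∉ ω
      exact fun h ↦ hr' (Or.inr ⟨h, a4⟩)
  · intro k hk
    rw [hplen] at hk
    rw [hek k hk]
    exact hann (j₁ + 1 + k) (by omega) (by omega)
  · -- the first face touches `∂Λ_{r-1}`: it has a vertex of norm `< r` and one of norm `≥ r`
    have hlow : ∃ u ∈ hexFaceVertices (w.getVert (j₁ + 1)), (r : ℤ) ≤ triNorm u := by
      rcases Nat.lt_or_ge (j₁ + 1) j₂ with h | h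
      · exact ⟨hw.lv (j₁ + 1), hw.lv_mem_hexFaceVertices (by omega), (hann (j₁ + 1) (by omega) h).1⟩
      · have e1 : j₁ + 1 = j₂ := by omega
        rw [e1]
        rcases hj₂spec with h2 | h2
        · exact ⟨hw.lv j₂, hw.lv_mem_hexFaceVertices hj₂len, by omega⟩
        · exact ⟨hw.rv j₂, hw.rv_mem_hexFaceVertices hj₂len, by omega⟩
    obtain ⟨u, hu, hur⟩ := hlow
    rcases hj₁spec with h1 | h1
    · refine ⟨hw.lv j₁, hw.lv_mem_hexFaceVertices_succ (by omega), ?_⟩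
      have := triNorm_le_of_mem_hexFaceVertices (hw.lv_mem_hexFaceVertices_succ (by omega)) hu
      omega
    · refine ⟨hw.rv j₁, hw.rv_mem_hexFaceVertices_succ (by omega), ?_⟩
      have := triNorm_le_of_mem_hexFaceVertices (hw.rv_mem_hexFaceVertices_succ (by omega)) hu
      omega
  · -- the last face touches `∂Λ_{R+1}`: it has a vertex of norm `> R` and one of norm `≤ R`
    have hupp : ∃ u ∈ hexFaceVertices (w.getVert j₂), triNorm u ≤ R := by
      rcases Nat.lt_or_ge (j₁ + 1) j₂ with h | h
      · refine ⟨hw.lv (j₂ - 1), ?_, (hann (j₂ - 1) (by omega) (by omega)).2.1⟩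
        have := hw.lv_mem_hexFaceVertices_succ (i := j₂ - 1) (by omega)
        rwa [show j₂ - 1 + 1 = j₂ by omega] at this
      · have e1 : j₁ + 1 = j₂ := by omega
        rw [← e1]
        rcases hj₁spec with h1 | h1
        · exact ⟨hw.lv j₁, hw.lv_mem_hexFaceVertices_succ (by omega), by omega⟩
        · exact ⟨hw.rv j₁, hw.rv_mem_hexFaceVertices_succ (by omega), by omega⟩
    obtain ⟨u, hu, huR⟩ := hupp
    rcases hj₂spec with h2 | h2
    · refine ⟨hw.lv j₂, hw.lv_mem_hexFaceVertices hj₂len, ?_⟩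
      have := triNorm_le_of_mem_hexFaceVertices hu (hw.lv_mem_hexFaceVertices hj₂len)
      omega
    · refine ⟨hw.rv j₂, hw.rv_mem_hexFaceVertices hj₂len, ?_⟩
      have := triNorm_le_of_mem_hexFaceVertices hu (hw.rv_mem_hexFaceVertices hj₂len)
      omega

/-! ### Interface walks of a finite configuration lie on interface loops -/

/-- **The exit side of a face crossed by an interface dart.** If a dart of `𝕋` with open tail
and closed head has right face `F` and left face `G`, the interface successor of `F` is `G`.
[folklore] -/
theorem ifaceSucc_eq_some_of_triEdgeFaces {ω : SiteConfig (Site 2)} {u v : Site 2} (h : triGraph.Adj u v)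
    {G F : HexVertex} (he : triEdgeFaces ⟨(u, v), h⟩ = (G, F)) (hu : u ∈ ω) (hv : v ∉ ω) :
    ifaceSucc ω F = some G := by
  obtain ⟨J, h1, hv', hu'⟩ := exists_sideIdx_of_triEdgeFaces h
  rw [he] at h1 hv' hu'
  dsimp only at h1 hv' hu'
  have hJ : IsExitSide ω F J := ⟨hv' ▸ hv, hu' ▸ hu⟩
  rw [ifaceSucc_eq_some hJ, h1]

/-- **An interface walk of a configuration with finitely many open sites lies on an interface
loop**: every face of the walk is a face of the interface loop through its first crossed dart
(both follow the injective interface-successor map `ifaceSucc`, and the loop closes up;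
Bollobás–Riordan 2006, Ch. 7 p. 178; Camia–Newman 2006, §4: in a finite region all cluster
interfaces are loops). [cite: BollobasRiordan2006, Ch. 7 p. 178] -/
theorem exists_isSiteInterfaceLoop_of_interfaceWalk {ω : SiteConfig (Site 2)} (hfin : ω.Finite) {F G : HexVertex}
    (p : hexGraph.Walk F G) (e : ℕ → triGraph.Dart)
    (he : ∀ i < p.length, triEdgeFaces (e i) = (p.getVert (i + 1), p.getVert i) ∧ (e i).fst ∈ ω ∧ (e i).snd ∉ ω)
    (hlen : 0 < p.length) :
    ∃ w : hexGraph.Walk F F, IsSiteInterfaceLoop ω w ∧ ∀ k ≤ p.length, p.getVert k ∈ w.support := by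
  obtain ⟨hf0, ho0, hc0⟩ := he 0 hlen
  have hd0 : e 0 = ⟨((e 0).fst, (e 0).snd), (e 0).adj⟩ := rfl
  rw [hd0] at hf0
  obtain ⟨F₀, w, hw, hfaces⟩ := exists_isSiteInterfaceLoop_of_adj hfin (e 0).adj ho0 hc0
  have hb := hf0.symm.trans hfaces
  simp only [Prod.mk.injEq, zero_add, SimpleGraph.Walk.getVert_zero] at hb
  obtain ⟨hb1, rfl⟩ := hb
  have hwlen : 0 < w.length := by have := hw.isCycle.three_le_length; omega
  refine ⟨w, hw, ?_⟩
  -- both follow the successor map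
  have hsucc : ∀ k < p.length, ifaceSucc ω (p.getVert k) = some (p.getVert (k + 1)) := by
    intro k hk
    obtain ⟨hf, ho, hc⟩ := he k hk
    have hd : e k = ⟨((e k).fst, (e k).snd), (e k).adj⟩ := rfl
    rw [hd] at hf
    exact ifaceSucc_eq_some_of_triEdgeFaces (e k).adj hf ho hc
  have key : ∀ k ≤ p.length, ∃ j < w.length, p.getVert k = w.getVert j := by
    intro k
    induction k with
    | zero => exact fun _ ↦ ⟨0, hwlen, by rw [SimpleGraph.Walk.getVert_zero, SimpleGraph.Walk.getVert_zero]⟩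
    | succ k ih =>
      intro hk
      obtain ⟨j, hj, hjk⟩ := ih (by omega)
      have h1 := hsucc k (by omega)
      rw [hjk, hw.ifaceSucc_getVert hj] at h1
      have h2 : w.getVert (j + 1) = p.getVert (k + 1) := Option.some_injective _ h1
      by_cases hj1 : j + 1 < w.length
      · exact ⟨j + 1, hj1, h2.symm⟩
      · refine ⟨0, hwlen, ?_⟩
        rw [← h2, show j + 1 = w.length by omega, SimpleGraph.Walk.getVert_length, SimpleGraph.Walk.getVert_zero]
  intro k hk
  obtain ⟨j, -, hj⟩ := key k hk
  rw [hj]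
  exact w.getVert_mem_support j

/-! ### Loop forms -/

/-- **An interface loop visiting a face at `Λ_r` and a face at `∂Λ_R` or beyond realises the
two-arm event** `armEvent (open, closed) (r+1) (R-1)` (`r + 2 ≤ R`): rotate the loop to the
inner face and apply `mem_armEvent_two_of_interfaceWalk` to its initial segment up to the outer
face. [cite: SmirnovWernerMRL2001, §4 Remark 6 and (15)] -/
theorem IsSiteInterfaceLoop.mem_armEvent_two {ω : SiteConfig (Site 2)} {f₀ : HexVertex} {w : hexGraph.Walk f₀ f₀}
    (hw : IsSiteInterfaceLoop ω w) {r R : ℕ} (hrR : r + 2 ≤ R) {F G : HexVertex} (hF : F ∈ w.support)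
    (hG : G ∈ w.support) (hFv : ∃ v ∈ hexFaceVertices F, triNorm v ≤ r)
    (hGv : ∃ v ∈ hexFaceVertices G, (R : ℤ) ≤ triNorm v) :
    ω ∈ armEvent ![true, false] (r + 1) (R - 1) := by
  classical
  -- rotate to `F`
  set w' := w.rotate F hF with hw'
  have hw'i : IsSiteInterfaceLoop ω w' := hw.rotate' hF
  have hG' : G ∈ w'.support := by rw [hw', SimpleGraph.Walk.mem_support_rotate_iff]; exact hG
  obtain ⟨n, hn, hnle⟩ := SimpleGraph.Walk.mem_support_iff_exists_getVert.1 hG'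
  -- the initial segment up to `G`
  set p : hexGraph.Walk F G := (w'.take n).copy rfl hn with hp
  have hplen : p.length = n := by
    rw [hp, SimpleGraph.Walk.length_copy, SimpleGraph.Walk.take_length]; exact min_eq_left hnle
  have hpget : ∀ k ≤ n, p.getVert k = w'.getVert k := by
    intro k hk
    rw [hp, SimpleGraph.Walk.getVert_copy, SimpleGraph.Walk.take_getVert, min_eq_right hk]
  have hwlen : 0 < w'.length := by have := hw'i.isCycle.three_le_length; omega
  set e : ℕ → triGraph.Dart := fun k ↦ if h : k < w'.length then
    ⟨(hw'i.lv k, hw'i.rv k), hw'i.adj_lv_rv h⟩ else ⟨(hw'i.lv 0, hw'i.rv 0), hw'i.adj_lv_rv hwlen⟩ with he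
  refine mem_armEvent_two_of_interfaceWalk p e (fun k hk ↦ ?_) hrR hFv hGv
  rw [hplen] at hk
  by_cases hkl : k < w'.length
  · obtain ⟨h', hf, hl, hr'⟩ := hw'i.dart_spec hkl
    simp only [he, dif_pos hkl]
    rw [hpget k (by omega), hpget (k + 1) (by omega)]
    exact ⟨hf, hl, hr'⟩
  · -- `k = n = length`: impossible since `k < n ≤ length`
    omega

/-- **Two arms force an interface loop across the annulus** (configurations with finitely many
open sites, e.g. the restricted configurations `ω ∩ triMeshVertices D δ` of the Camia–Newman loop
process `triLoopCollection`): if `ω ∈ armEvent (open, closed) r R` (`1 ≤ r ≤ R`), some interface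
loop of `ω` visits a face with a vertex on `∂Λ_{r-1}` and a face with a vertex on `∂Λ_{R+1}`,
the stretch between them crossing only edges of the annulus `{r ≤ |·|_𝕋 ≤ R}`
(`exists_interfaceWalk_of_mem_armEvent_two` and `exists_isSiteInterfaceLoop_of_interfaceWalk`).
[cite: SmirnovWernerMRL2001, §4 Remark 6 and (15)] -/
theorem exists_isSiteInterfaceLoop_of_mem_armEvent_two {ω : SiteConfig (Site 2)} (hfin : ω.Finite) {r R : ℕ}
    (hr : 1 ≤ r) (hrR : r ≤ R) (hω : ω ∈ armEvent ![true, false] r R) :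
    ∃ (F : HexVertex) (w : hexGraph.Walk F F), IsSiteInterfaceLoop ω w ∧
      (∃ v ∈ hexFaceVertices F, triNorm v + 1 = r) ∧
      ∃ G ∈ w.support, ∃ v ∈ hexFaceVertices G, triNorm v = R + 1 := by
  obtain ⟨F, G, p, e, he, hann, hF, hG⟩ := exists_interfaceWalk_of_mem_armEvent_two hr hrR hω
  -- the walk is not trivial: its end faces have vertices of norms `r - 1` and `R + 1`
  have hlen : 0 < p.length := by
    by_contra h0
    have hFG : F = G := by
      have := p.getVert_of_length_le (show p.length ≤ 0 by omega)
      rw [← this, SimpleGraph.Walk.getVert_zero]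
    subst hFG
    obtain ⟨a, ha, har⟩ := hF
    obtain ⟨b, hb, hbR⟩ := hG
    have := triNorm_le_of_mem_hexFaceVertices ha hb
    omega
  obtain ⟨w, hw, hsupp⟩ := exists_isSiteInterfaceLoop_of_interfaceWalk hfin p e he hlen
  refine ⟨F, w, hw, hF, G, ?_, hG⟩
  have := hsupp p.length le_rfl
  rwa [SimpleGraph.Walk.getVert_length] at this

/-! ### Trace forms at mesh `δ` -/

/-- Subadditivity of the graph norm of `𝕋` (a private copy; cf. `triNorm_add_le` in
`CutPointArms.lean`, not imported here). [folklore] -/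
private theorem triNorm_le_add_triNorm_sub (x v : Site 2) : triNorm x ≤ triNorm v + triNorm (x - v) := by
  rw [triNorm_le_iff]
  have h0 : ∀ y : Site 2, |y 0| ≤ triNorm y := fun y ↦ le_max_left _ _
  have h1 : ∀ y : Site 2, |y 1| ≤ triNorm y := fun y ↦ (le_max_left _ _).trans (le_max_right _ _)
  have h2 : ∀ y : Site 2, |y 0 + y 1| ≤ triNorm y := fun y ↦ (le_max_right _ _).trans (le_max_right _ _)
  refine ⟨?_, ?_, ?_⟩
  · calc |x 0| = |v 0 + (x - v) 0| := by simp
      _ ≤ |v 0| + |(x - v) 0| := abs_add_le _ _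
      _ ≤ _ := add_le_add (h0 v) (h0 (x - v))
  · calc |x 1| = |v 1 + (x - v) 1| := by simp
      _ ≤ |v 1| + |(x - v) 1| := abs_add_le _ _
      _ ≤ _ := add_le_add (h1 v) (h1 (x - v))
  · calc |x 0 + x 1| = |(v 0 + v 1) + ((x - v) 0 + (x - v) 1)| := by simp; ring_nf
      _ ≤ |v 0 + v 1| + |(x - v) 0 + (x - v) 1| := abs_add_le _ _
      _ ≤ _ := add_le_add (h2 v) (h2 (x - v))

/-- **Two arms force an interface loop whose trace comes within one mesh of `δ ∂Λ_{r-1}` and of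
`δ ∂Λ_{R+1}`** (trace form of `exists_isSiteInterfaceLoop_of_mem_armEvent_two`, for the polygonal
traces `polyTrace δ w` of which the Camia–Newman loop collection `triLoopCollection` consists):
some interface loop of `ω` has a trace point within `δ` of the mesh point of a site of norm
`r - 1` and a trace point within `δ` of the mesh point of a site of norm `R + 1` (the centre of a
face is within `δ/√3 ≤ δ` of its vertices). [cite: SmirnovWernerMRL2001, §4 Remark 6 and (15)] -/
theorem exists_isSiteInterfaceLoop_polyTrace_of_mem_armEvent_two {ω : SiteConfig (Site 2)} (hfin : ω.Finite)
    {r R : ℕ} (hr : 1 ≤ r) (hrR : r ≤ R) (hω : ω ∈ armEvent ![true, false] r R) {δ : ℝ} (hδ : 0 < δ) :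
    ∃ (F : HexVertex) (w : hexGraph.Walk F F), IsSiteInterfaceLoop ω w ∧
      (∃ z ∈ polyTrace δ w, ∃ v : Site 2, triNorm v + 1 = r ∧ dist z (triMeshPoint δ v) ≤ δ) ∧
      (∃ z ∈ polyTrace δ w, ∃ v : Site 2, triNorm v = R + 1 ∧ dist z (triMeshPoint δ v) ≤ δ) := by
  obtain ⟨F, w, hw, ⟨v, hv, hvr⟩, G, hG, v', hv', hv'R⟩ := exists_isSiteInterfaceLoop_of_mem_armEvent_two hfin hr hrR hω
  have hlen : 0 < w.length := by have := hw.isCycle.three_le_length; omega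
  -- the centre of the `n`-th face is on the trace
  have hcen : ∀ n ≤ w.length, (δ : ℂ) * hexCenter (w.getVert n) ∈ polyTrace δ w := by
    intro n hn
    rcases Nat.lt_or_ge n w.length with h | h
    · exact polyPiece_subset_polyTrace h (left_mem_segment _ _ _)
    · obtain rfl : n = w.length := le_antisymm hn h
      have e1 : (δ : ℂ) * hexCenter (w.getVert w.length) = polyPt δ w 0 := by
        rw [SimpleGraph.Walk.getVert_length, polyPt, w.getVert_zero]
      rw [e1]
      exact polyPiece_subset_polyTrace hlen (left_mem_segment _ _ _)
  have habs : |δ| = δ := abs_of_pos hδ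
  refine ⟨F, w, hw, ⟨(δ : ℂ) * hexCenter F, ?_, v, hvr, ?_⟩, ?_⟩
  · have := hcen 0 (Nat.zero_le _); rwa [SimpleGraph.Walk.getVert_zero] at this
  · rw [dist_comm]; exact (dist_triMeshPoint_hexCenter_le hv δ).trans habs.le
  · obtain ⟨n, hn, hnle⟩ := SimpleGraph.Walk.mem_support_iff_exists_getVert.1 hG
    refine ⟨(δ : ℂ) * hexCenter G, ?_, v', hv'R, ?_⟩
    · rw [← hn]; exact hcen n hnle
    · rw [dist_comm]; exact (dist_triMeshPoint_hexCenter_le hv' δ).trans habs.le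

/-- **An interface loop whose trace comes within one mesh of `δ Λ_r` and of the outside of
`δ Λ̊_R` realises the two-arm event `armEvent (open, closed) (r+3) (R-3)`** (`r + 6 ≤ R`; trace form
of `IsSiteInterfaceLoop.mem_armEvent_two`: a trace point is within `δ` of the open site on the
left of its dart, so that site is within `|·|_𝕋`-distance `2` of the given site).
[cite: SmirnovWernerMRL2001, §4 Remark 6 and (15)] -/
theorem IsSiteInterfaceLoop.mem_armEvent_two_of_polyTrace {ω : SiteConfig (Site 2)} {f₀ : HexVertex}
    {w : hexGraph.Walk f₀ f₀} (hw : IsSiteInterfaceLoop ω w) {δ : ℝ} (hδ : 0 < δ) {r R : ℕ} (hrR : r + 6 ≤ R)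
    {z z' : ℂ} (hz : z ∈ polyTrace δ w) (hz' : z' ∈ polyTrace δ w) {v v' : Site 2}
    (hv : triNorm v ≤ r) (hzv : dist z (triMeshPoint δ v) ≤ δ)
    (hv' : (R : ℤ) ≤ triNorm v') (hzv' : dist z' (triMeshPoint δ v') ≤ δ) :
    ω ∈ armEvent ![true, false] (r + 3) (R - 3) := by
  have h3 : (4 : ℝ) / 3 < Real.sqrt 3 := by
    have h := Real.sq_sqrt (show (0 : ℝ) ≤ 3 by norm_num)
    nlinarith [Real.sqrt_nonneg 3]
  -- the left sites of the darts through `z` and `z'`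
  have key : ∀ {y : ℂ} {u : Site 2}, y ∈ polyTrace δ w → dist y (triMeshPoint δ u) ≤ δ →
      ∃ i < w.length, triNorm (hw.lv i - u) < 3 := by
    intro y u hy hyu
    obtain ⟨i, hi, hyi⟩ := mem_polyTrace_iff.1 hy
    have h1 : dist y (triMeshPoint δ (hw.lv i)) ≤ δ := hw.polyPiece_subset_closedBall hδ.le hi hyi
    refine ⟨i, hi, triNorm_lt_of_dist_triMeshPoint_lt hδ ?_⟩
    have := dist_triangle_left (triMeshPoint δ (hw.lv i)) (triMeshPoint δ u) y
    push_cast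
    nlinarith
  obtain ⟨i, hi, hiu⟩ := key hz hzv
  obtain ⟨i', hi', hiu'⟩ := key hz' hzv'
  have hin : triNorm (hw.lv i) ≤ r + 2 := by
    have := triNorm_le_add_triNorm_sub (hw.lv i) v; omega
  have hout : ((R - 2 : ℕ) : ℤ) ≤ triNorm (hw.lv i') := by
    have h1 := triNorm_le_add_triNorm_sub v' (hw.lv i')
    have h2 : triNorm (v' - hw.lv i') = triNorm (hw.lv i' - v') := by rw [← triNorm_neg, neg_sub]
    push_cast [show 2 ≤ R by omega]
    omega
  have h := hw.mem_armEvent_two (r := r + 2) (R := R - 2) (by omega) (w.getVert_mem_support i)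
    (w.getVert_mem_support i') ⟨hw.lv i, hw.lv_mem_hexFaceVertices hi, by exact_mod_cast hin⟩
    ⟨hw.lv i', hw.lv_mem_hexFaceVertices hi', hout⟩
  rwa [show R - 2 - 1 = R - 3 by omega] at h

end Literature.Probability.Percolation
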